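import Summits.HodgeConjecture.CorCM.HypDel.A1ReflexCompositumModel
import Literature.AlgebraicGeometry.ShimuraVarieties.UnitaryAuxiliaryHeckeQuotientDescentGeneral
import HarnessLib

/-!
# Line `a1-reflex-compositum`, stub (A) `stub_reflexCompositumModel` — CLOSED CONDITIONALLY ON THE PRINTED CITATION F1 ONLY
# (binder `hDel` → `HypDel`; cell hodgecm-mathlib, fan A, rung A-I, KEY a1-reflex-compositum-model, seat A-p05)

Skeleton of record: `A-plan/lines/a1-reflex-compositum.lean` sha16 785cc48e2d31c68c; stub (A) text :88–:112 VERBATIM as the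
conclusion.  HC_CM is proved only modulo the 7 printed citations until rung 0 closes; `hDel` is one of them, and THIS file
replaces it — on the line a1, for the stub (A) that carries the whole Galois leg `hDel♭` (skeleton's PROVED
`galoisCase_of_reflexCompositumModel`) — by the single printed citation F1 = `Aux.canonicalModel_exists_printed`
([Deligne1979ShimuraVarieties] 2.3.1 read on the Hodge-type auxiliary datum `(G × T₀, X × {h_Φ})`, named fact p591128), taken as the
hypothesis `hF1` BY NAME (D-0014): `stub_reflexCompositumModel_of_F1 hF1 : <stub (A)>`.  Everything else is PROVED in the
tree: the finite Hecke quotient (5.11.1) on the auxiliary carriers (B-p05/B-p06/B-p07), the reflex transport in general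
degree ((a′) p594845, (b′) p595207, (d′) kernel-twist invariance p594589 — Kronecker + `T₃(ℚ)` fixes the CM point), g4
(p592936), the class-number finiteness g5 (`Aux.finite_classGroup_printed_holds`, p596070, [BorelIHES1963] Thm. 5.1 for `T₀`
PROVED), the unit level g6 (p595606), the A-side bookkeeping (adapted `Φ`, `E♯ ↪ E`) and the tower step `E♯ → E`.

References: [Deligne1979ShimuraVarieties] 2.2.5, 2.3.1; [Deligne1971TravauxShimura] Prop. 5.11, (5.11.1), Cor. 5.7;
[Milne2005ShimuraVarieties] Def. 12.8 (59)–(62); [Liu2021] App. C Lem. C.14, Rem. C.15; [BorelIHES1963] Thm. 5.1.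
-/

set_option autoImplicit false

noncomputable section

open Function MulAction NumberField IsDedekindDomain CategoryTheory CategoryTheory.Limits Matrix
  AlgebraicGeometry
open scoped Matrix ComplexOrder
open Literature.AlgebraicGeometry Literature.AlgebraicGeometry.Motives
open Literature.NumberTheory.Automorphic Literature.NumberTheory.Automorphic.UnitaryGroup
open Literature.NumberTheory.Automorphic.Liu2021.AppendixC (C5.OpenCompactSubgroup C5.SmallLevel)
open Literature.Geometry.ComplexHyperbolic Literature.Geometry.ComplexHyperbolic.BallModel
open Literature.NumberTheory.Automorphic.ShimuraDissection
open Literature.AlgebraicGeometry.ShimuraVarieties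
open Literature.AlgebraicGeometry.ShimuraVarieties.UnitaryCanonicalModel
open Literature.NumberTheory.ComplexMultiplication (traceField traceField_le_fieldRange)

namespace Summit.HodgeConjecture.CorCM.Cruxes.HypDel.ReflexCompositum

/-- **Stub (A) `stub_reflexCompositumModel` of line a1, CONDITIONAL ON F1 ONLY**: for every hDel datum
`(L, H, τ, T, hT)` (positive definite off `τ`, anisotropic), every neat `K₀` and every complex record system `Sc`, there is a
CM type `Φ` of `L` (any `τ`-adapted one) such that for every number field `E ⊂ ℂ` containing `τ(L)` and `E*(Φ)` the tower
`Sc.Mc` has an `E`-form with Shimura reciprocity (62) for `Aut(ℂ/E)` at the diagonal special pairs, in the binder's `L`-idèle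
convention — the skeleton's text VERBATIM.  `:= stub_reflexCompositumModel_of_galoisLegOver (galoisLegDescentOver_general_of_F1 hF1)
Aux.finite_classGroup_printed_holds (fun L => ⟨Aux.unitLevel L⟩)`.  Consumers: the skeleton's
`galoisCase_of_reflexCompositumModel (stub_reflexCompositumModel_of_F1 hF1)` is `hDel♭` (Galois `L`) modulo F1;
`canonicalModel_exists_printed_of (stub_reflexCompositumModel_of_F1 hF1) hB` is `hDel` modulo F1 and the TIER-G residual (B).
[cite: Deligne1979ShimuraVarieties, 2.2.5 and 2.3.1] [cite: Deligne1971TravauxShimura, Prop. 5.11, (5.11.1), Cor. 5.7]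
[cite: Milne2005ShimuraVarieties, Def. 12.8 (59)–(62) pp. 107–114] [cite: Liu2021, App. C Lem. C.14, Rem. C.15] -/
theorem stub_reflexCompositumModel_of_F1 (hF1 : Aux.canonicalModel_exists_printed) :
        ∀ (L : Type) [Field L] [NumberField L] [IsCMField L] (H : Matrix (Fin 3) (Fin 3) L) (τ : L →+* ℂ)
      (T : GL (Fin 3) ℂ) (hT : formCongr (starRingEnd ℂ) T (H.map τ) = BallModel.J),
      (∀ τ' : L →+* ℂ, InfinitePlace.mk τ' ≠ InfinitePlace.mk τ → (H.map τ').PosDef) →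
      (∀ v : Fin 3 → L, hermForm (cmConjRingHom L) H v v = 0 → v = 0) →
      ∀ K₀ : C5.OpenCompactSubgroup ↥(finAdelic (↥(maximalRealSubfield L)) L (IsCMField.complexConj L) 3 H),
        (∀ g : finAdelic (↥(maximalRealSubfield L)) L (IsCMField.complexConj L) 3 H,
          ∀ γ ∈ arithmeticLevel (↥(maximalRealSubfield L)) L (IsCMField.complexConj L) 3 H
            (K₀.1.map (MulAut.conj g).toMonoidHom), IsOfFinOrder γ → γ = 1) →
          ∀ Sc : ComplexRecordSystem L H τ T hT K₀,
            ∃ Φ : CMType L, ∀ (E : Type) [Field E] [NumberField E] (ιE : E →+* ℂ),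
              Set.range τ ⊆ Set.range ιE → (traceField Φ : Set ℂ) ⊆ Set.range ιE →
              ∃ (M : C5.SmallLevel K₀ ⥤ SchemeOver E) (e : (M ⋙ baseChangeHom ιE) ≅ Sc.Mc),
              letI : Algebra E ℂ := ιE.toAlgebra
              ∀ (K : C5.SmallLevel K₀) (σ : ℂ ≃ₐ[E] ℂ) (s : (FiniteAdeleRing (𝓞 L) L)ˣ),
                IsArtinCorrespondent L τ s σ.toRingEquiv →
                ∀ (v₃ : Fin 3 → L) (x : Ball), IsLinePoint L τ T v₃ x →
                  ∀ d : finAdelic (↥(maximalRealSubfield L)) L (IsCMField.complexConj L) 3 H,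
                    IsDiagTwist L H v₃ (recipFactor L s) d →
                    ∀ a : finAdelic (↥(maximalRealSubfield L)) L (IsCMField.complexConj L) 3 H,
                      σ • (AlgPoints.baseChangeEquiv ιE (M.obj K)).symm
                          (AlgPoints.map (e.inv.app K) ((Sc.pts K).symm (ShimuraSet.mk L H τ T hT K.1.1 x a))) =
                        (AlgPoints.baseChangeEquiv ιE (M.obj K)).symm
                          (AlgPoints.map (e.inv.app K)
                            ((Sc.pts K).symm (ShimuraSet.mk L H τ T hT K.1.1 x (d * a)))) :=
  stub_reflexCompositumModel_of_galoisLegOver (HeckeQuotient.galoisLegDescentOver_general_of_F1 hF1)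
    Aux.finite_classGroup_printed_holds (fun L _ _ _ => ⟨Aux.unitLevel L⟩)

end Summit.HodgeConjecture.CorCM.Cruxes.HypDel.ReflexCompositum

end
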